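import Summits.CriticalPhenomena.Ising3DConformalLimit.Theses.InverseSquareTelemetry
import Summits.CriticalPhenomena.Ising3DConformalLimit.Theorems.InverseSquareTelemetryInverseSquareLawAxialTauberian
import Literature.Probability.LatticeModels.AxisSpectralRepresentationProofs
import Literature.Probability.LatticeModels.CriticalTwoPointBounds
import HarnessLib

/-!
# Crux `InverseSquareLaw` (stmt-CriticalPhenomena-4495): the pure power law (item 0634) already gives the
# AXIAL half of the telemetric limit, `n²·[G((n+1)eᵢ) + G((n−1)eᵢ) − 2G(neᵢ)]/G(neᵢ) → a(a+1)`

Route `InverseSquareTelemetry`, sub-problem `Ising3DConformalLimit`; THEOREM-ONLY helper file (lead c3).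
Write `G = criticalTwoPoint 3`. At an axis site `x = n eᵢ` the six-neighbour Laplacian splits as
`ΔG(x) = Δ∥G(x) + Δ⊥G(x)` (`…AxialSigns`: `Δ∥ ≥ 0` by log-convexity, `Δ⊥ ≤ 0` by Messager–Miracle-Solé),
so the telemetry `T(x) = |x|² ΔG/G` of the crux (stub S1: `T → κ`) is `T∥ + T⊥`. This file proves that the
AXIAL part has a limit as soon as the two-point function is a pure power law:

**Theorem (`axialTelemetry_of_powerLaw`).** If `G(x)·|x|₂^a → c > 0` along the cofinite filter of `ℤ³`
(for `a = 2Δ` this is item stmt-CriticalPhenomena-0634, `IsingEuclidUpgradeR2RotInvPowerLaw`), then for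
every axis `i`, `n² · [G((n+1)eᵢ) + G((n−1)eᵢ) − 2 G(n eᵢ)] / G(n eᵢ) → a (a+1)`.

Mechanism: along an axis `n ↦ G(n eᵢ)` is a HAUSDORFF MOMENT SEQUENCE, `G(n eᵢ) = ∫ tⁿ dν(t)` with `ν`
finite on `[0,1]` (reflection positivity / transfer-matrix spectral representation, Aizenman–Duminil-Copin
2021 Prop. 8.6, a tree theorem: `AizenmanDuminilCopin2021_prop_8_6_holds.hausdorffMoment`, at `β_c`
where `m*(β_c) = 0`), hence its first and second differences are non-increasing; the discrete monotone
density theorem (`AxialTauberian.tendsto_secondDiff_mul_rpow`, Bingham–Goldie–Teugels Thm. 1.7.2) turns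
the pure power law `G(n eᵢ) nᵃ → c` into `Δ∥G(neᵢ) · n^{a+2} → c a(a+1)`.

So item 0634 ⇒ `T∥(neᵢ) → a(a+1)` (`= (1+η)(2+η) ≈ 2.11`); what 0634 does NOT give is the transverse
part `T⊥(neᵢ) = 4n²[G(neᵢ+eⱼ) − G(neᵢ)]/G(neᵢ) → −2a`, a statement about `G` one lattice step OFF the
axis at relative precision `o(n⁻²)` — this is the irreducible content of stub S1 beyond the pure power
law (`axialTelemetry_of_rotInvPowerLaw`, docstring).
-/

noncomputable section

namespace Summit.CriticalPhenomena.Ising3DConformalLimit.Theorems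

open Filter Topology MeasureTheory Set Literature.Probability.LatticeModels
open Summit.CriticalPhenomena.Ising3DConformalLimit.Theses.InverseSquareTelemetry

namespace AxialTelemetry

/-- **The critical axis two-point function of `ℤ³` is a Hausdorff moment sequence**:
`G(n eᵢ) = ∫ tⁿ dν` for a finite measure `ν` carried by `[0,1]` (Aizenman–Duminil-Copin 2021,
Prop. 8.6 at `β_c`, where `m*(β_c) = 0`; tree theorems). [folklore] -/
theorem axis_hausdorffMoment (i : Fin 3) :
    ∃ ν : Measure ℝ, IsFiniteMeasure ν ∧ ν (Icc (0 : ℝ) 1)ᶜ = 0 ∧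
      ∀ n : ℕ, criticalTwoPoint 3 (Pi.single i (n : ℤ)) = ∫ t, t ^ n ∂ν := by
  have hβ : 0 < criticalBeta (2 + 1) := criticalBeta_pos_holds (d := 2 + 1) (by norm_num)
  have hm : spontaneousMagnetization (2 + 1) (criticalBeta (2 + 1)) = 0 :=
    spontaneousMagnetization_criticalBeta_eq_zero_holds (d := 2 + 1) (by norm_num)
  obtain ⟨ν, hfin, hsupp, hrep⟩ :=
    AizenmanDuminilCopin2021_prop_8_6_holds.hausdorffMoment (d' := 2) hβ hm i
  exact ⟨ν, hfin, hsupp, fun n => hrep n⟩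

variable {ν : Measure ℝ} [IsFiniteMeasure ν]

omit [IsFiniteMeasure ν] in
/-- `t ∈ [0,1]` for `ν`-a.e. `t` when `ν` is carried by `[0,1]`. [folklore] -/
theorem ae_mem_Icc (hsupp : ν (Icc (0 : ℝ) 1)ᶜ = 0) : ∀ᵐ t ∂ν, t ∈ Icc (0 : ℝ) 1 :=
  mem_ae_iff.2 hsupp

/-- Powers are `ν`-integrable (bounded by `1` a.e. on a finite measure). [folklore] -/
theorem integrable_pow (hsupp : ν (Icc (0 : ℝ) 1)ᶜ = 0) (n : ℕ) : Integrable (fun t : ℝ => t ^ n) ν := by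
  refine Integrable.mono' (integrable_const (1 : ℝ)) (continuous_pow n).aestronglyMeasurable ?_
  filter_upwards [ae_mem_Icc hsupp] with t ht
  rw [Real.norm_eq_abs, abs_pow, abs_of_nonneg ht.1]
  exact pow_le_one₀ ht.1 ht.2

/-- First differences of a Hausdorff moment sequence are non-increasing:
`∫ tʲ − ∫ tʲ⁺¹ ≤ ∫ tⁱ − ∫ tⁱ⁺¹` for `i ≤ j` (`(1−t)(tⁱ − tʲ) ≥ 0` on `[0,1]`). [folklore] -/
theorem moment_diff_antitone (hsupp : ν (Icc (0 : ℝ) 1)ᶜ = 0) {i j : ℕ} (hij : i ≤ j) :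
    (∫ t, t ^ j ∂ν) - (∫ t, t ^ (j + 1) ∂ν) ≤ (∫ t, t ^ i ∂ν) - (∫ t, t ^ (i + 1) ∂ν) := by
  have hI := integrable_pow hsupp
  rw [← integral_sub (hI j) (hI (j + 1)), ← integral_sub (hI i) (hI (i + 1))]
  refine integral_mono_ae ((hI j).sub (hI (j + 1))) ((hI i).sub (hI (i + 1))) ?_
  filter_upwards [ae_mem_Icc hsupp] with t ht
  have h1 : t ^ j ≤ t ^ i := pow_le_pow_of_le_one ht.1 ht.2 hij
  have h2 : 0 ≤ 1 - t := by linarith [ht.2]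
  have : t ^ j - t ^ (j + 1) ≤ t ^ i - t ^ (i + 1) := by
    rw [pow_succ, pow_succ]
    nlinarith
  exact this

/-- Second differences of a Hausdorff moment sequence are non-increasing (the same with the density
`(1−t)²`). [folklore] -/
theorem moment_secondDiff_antitone (hsupp : ν (Icc (0 : ℝ) 1)ᶜ = 0) {i j : ℕ} (hij : i ≤ j) :
    ((∫ t, t ^ (j + 1) ∂ν) - (∫ t, t ^ (j + 2) ∂ν)) - ((∫ t, t ^ (j + 2) ∂ν) - (∫ t, t ^ (j + 3) ∂ν)) ≤
      ((∫ t, t ^ (i + 1) ∂ν) - (∫ t, t ^ (i + 2) ∂ν)) - ((∫ t, t ^ (i + 2) ∂ν) - (∫ t, t ^ (i + 3) ∂ν)) := by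
  have hI := integrable_pow hsupp
  have e : ∀ m : ℕ, ((∫ t, t ^ (m + 1) ∂ν) - (∫ t, t ^ (m + 2) ∂ν)) -
      ((∫ t, t ^ (m + 2) ∂ν) - (∫ t, t ^ (m + 3) ∂ν)) = ∫ t, t ^ (m + 1) * (1 - t) ^ 2 ∂ν := by
    intro m
    rw [← integral_sub (hI _) (hI _), ← integral_sub (hI _) (hI _), ← integral_sub]
    · refine integral_congr_ae (Eventually.of_forall fun t => ?_)
      simp only
      ring
    · exact (hI _).sub (hI _)
    · exact (hI _).sub (hI _)
  rw [e j, e i]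
  have hIw : ∀ m : ℕ, Integrable (fun t : ℝ => t ^ (m + 1) * (1 - t) ^ 2) ν := fun m => by
    have : (fun t : ℝ => t ^ (m + 1) * (1 - t) ^ 2) =
        fun t => t ^ (m + 1) - 2 * t ^ (m + 2) + t ^ (m + 3) := by
      funext t; ring
    rw [this]
    exact ((hI _).sub ((hI _).const_mul 2)).add (hI _)
  refine integral_mono_ae (hIw j) (hIw i) ?_
  filter_upwards [ae_mem_Icc hsupp] with t ht
  have h1 : t ^ (j + 1) ≤ t ^ (i + 1) := pow_le_pow_of_le_one ht.1 ht.2 (by omega)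
  exact mul_le_mul_of_nonneg_right h1 (sq_nonneg _)

/-- The Euclidean radius of an axis site: `√(Σⱼ (n eᵢ)ⱼ²) = n`. [folklore] -/
theorem sqrt_sumSq_single (i : Fin 3) (n : ℕ) :
    Real.sqrt (∑ j, (((Pi.single i (n : ℤ) : Site 3) j : ℝ)) ^ 2) = n := by
  have : (∑ j, (((Pi.single i (n : ℤ) : Site 3) j : ℝ)) ^ 2) = (n : ℝ) ^ 2 := by
    simp [Pi.single_apply, Finset.sum_ite_eq']
  rw [this, Real.sqrt_sq (Nat.cast_nonneg n)]

/-- `n ↦ n eᵢ` tends to the cofinite filter of `ℤ³` (it is injective). [folklore] -/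
theorem tendsto_single_cofinite (i : Fin 3) :
    Tendsto (fun n : ℕ => (Pi.single i (n : ℤ) : Site 3)) atTop cofinite := by
  have hinj : Function.Injective fun n : ℕ => (Pi.single i (n : ℤ) : Site 3) := by
    intro m n h
    have := congrFun h i
    simpa using this
  rw [← Nat.cofinite_eq_atTop]
  exact hinj.tendsto_cofinite

end AxialTelemetry

open AxialTelemetry

/-- **A pure power law for `G` gives the axial half of the telemetric limit.** If
`G(x)·|x|₂^a → c` cofinitely on `ℤ³` with `c > 0` (`G = criticalTwoPoint 3`), then along every axis
`n²·[G((n+1)eᵢ) + G((n−1)eᵢ) − 2G(neᵢ)]/G(neᵢ) → a(a+1)`: Hausdorff moment structure of the axis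
two-point function (reflection positivity) + the discrete monotone density theorem. [folklore] -/
theorem axialTelemetry_of_powerLaw {a c : ℝ} (hc : 0 < c)
    (hG : Tendsto (fun x : Site 3 => criticalTwoPoint 3 x * Real.sqrt (∑ j, ((x j : ℝ)) ^ 2) ^ a)
      cofinite (𝓝 c)) (i : Fin 3) :
    Tendsto (fun n : ℕ => (n : ℝ) ^ 2 * (criticalTwoPoint 3 (Pi.single i ((n + 1 : ℕ) : ℤ)) +
        criticalTwoPoint 3 (Pi.single i ((n - 1 : ℕ) : ℤ)) - 2 * criticalTwoPoint 3 (Pi.single i (n : ℤ))) /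
        criticalTwoPoint 3 (Pi.single i (n : ℤ))) atTop (𝓝 (a * (a + 1))) := by
  set u : ℕ → ℝ := fun n => criticalTwoPoint 3 (Pi.single i (n : ℤ)) with hu
  -- the axis power law `u n · n^a → c`
  have hpow : Tendsto (fun n : ℕ => u n * (n : ℝ) ^ a) atTop (𝓝 c) := by
    have h := hG.comp (tendsto_single_cofinite i)
    refine h.congr' (Eventually.of_forall fun n => ?_)
    simp only [Function.comp_apply, hu, sqrt_sumSq_single]
  -- monotone first and second differences from the Hausdorff moment representation
  obtain ⟨ν, hfin, hsupp, hrep⟩ := axis_hausdorffMoment i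
  have hanti : ∀ i' j, 0 ≤ i' → i' ≤ j → u j - u (j + 1) ≤ u i' - u (i' + 1) := by
    intro i' j _ hij
    simp only [hu, hrep]
    exact moment_diff_antitone hsupp hij
  have hanti2 : ∀ i' j, 0 ≤ i' → i' ≤ j →
      (u (j + 1) - u (j + 2)) - (u (j + 2) - u (j + 3)) ≤ (u (i' + 1) - u (i' + 2)) - (u (i' + 2) - u (i' + 3)) := by
    intro i' j _ hij
    simp only [hu, hrep]
    exact moment_secondDiff_antitone hsupp hij
  have h2 := AxialTauberian.tendsto_secondDiff_mul_rpow (N := 0) hpow hanti hanti2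
  -- divide by `u n · n^a → c`
  have hq := h2.div hpow hc.ne'
  rw [show c * a * (a + 1) / c = a * (a + 1) by field_simp] at hq
  refine hq.congr' ?_
  filter_upwards [eventually_gt_atTop 0] with n hn
  have hn' : (0 : ℝ) < n := by exact_mod_cast hn
  have hun : u n ≠ 0 := by
    have hx : (Pi.single i (n : ℤ) : Site 3) ≠ 0 := by
      intro h
      have := congrFun h i
      simp at this
      omega
    obtain ⟨c₀, C₀, hc₀, hb⟩ := criticalTwoPoint_bounds_holds (d := 3) le_rfl
    exact (lt_of_lt_of_le (mul_pos hc₀ (Real.rpow_pos_of_pos (norm_pos_iff.2 hx) _)) (hb _ hx).1).ne'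
  have hna : (n : ℝ) ^ a ≠ 0 := (Real.rpow_pos_of_pos hn' a).ne'
  simp only [Pi.div_apply]
  rw [show a + 2 = a + (2 : ℕ) by norm_num, Real.rpow_add_natCast hn'.ne']
  simp only [hu]
  push_cast
  field_simp

/-- **Item 0634 gives the axial half of stub S1.** If the critical two-point function of `ℤ³` is a
rotation-invariant pure power law, `G(x)·|x|₂^{2Δ} → c > 0` (`IsingEuclidUpgradeR2RotInvPowerLaw`,
item stmt-CriticalPhenomena-0634), then along every axis the AXIAL telemetry converges,
`n²·Δ∥G(neᵢ)/G(neᵢ) → 2Δ(2Δ+1)` (`= (1+η)(2+η)`). What remains of the telemetric limit S1 at axis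
sites is the TRANSVERSE part `T⊥ → −2(1+η)`, i.e. `G(neᵢ ± eⱼ)/G(neᵢ) = 1 − (1+η)/(2n²) + o(n⁻²)`,
which no pure power law along rays controls. [folklore] -/
theorem axialTelemetry_of_rotInvPowerLaw (h : IsingEuclidUpgradeR2RotInvPowerLaw) :
    ∃ Δ : ℝ, (∃ c : ℝ, 0 < c ∧ Tendsto (fun x : Site 3 => criticalTwoPoint 3 x *
        Real.sqrt (∑ j, ((x j : ℝ)) ^ 2) ^ (2 * Δ)) cofinite (𝓝 c)) ∧
      ∀ i : Fin 3, Tendsto (fun n : ℕ => (n : ℝ) ^ 2 *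
        (criticalTwoPoint 3 (Pi.single i ((n + 1 : ℕ) : ℤ)) + criticalTwoPoint 3 (Pi.single i ((n - 1 : ℕ) : ℤ)) -
          2 * criticalTwoPoint 3 (Pi.single i (n : ℤ))) / criticalTwoPoint 3 (Pi.single i (n : ℤ)))
        atTop (𝓝 (2 * Δ * (2 * Δ + 1))) := by
  obtain ⟨Δ, c, hc, hG⟩ := h
  exact ⟨Δ, ⟨c, hc, hG⟩, fun i => axialTelemetry_of_powerLaw hc hG i⟩

end Summit.CriticalPhenomena.Ising3DConformalLimit.Theorems
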